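import Literature.AlgebraicGeometry.Resolution.ResolutionOfSingularities
import Mathlib.AlgebraicGeometry.Morphisms.Finite
import Mathlib.AlgebraicGeometry.Morphisms.ClosedImmersion
import Mathlib.AlgebraicGeometry.Morphisms.IsIso
import Mathlib.AlgebraicGeometry.Limits
import HarnessLib

/-!
# Gluing resolutions along a decomposition into closed subschemes

Topic: `Literature/AlgebraicGeometry/Resolution`. Elementary glue on Mathlib's scheme library
for the weak notion of resolution of `ResolutionOfSingularities.lean` (`IsBirational`,
`IsResolution`, `Scheme.HasResolution`), used for the curve case of resolution
(`ResolutionOfCurves.lean`): if a reduced scheme `X` is the union of two closed subschemes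
`C, D ↪ X` none of which contains a component of the other (the complement of each is dense in the
other) and `C`, `D` admit *finite* resolutions, then the disjoint union of the two resolutions is
a finite resolution of `X` (`exists_finite_resolution_of_closed_cover`).

## Content (all [folklore])

* restriction API: `isIso_morphismRestrict_of_le`, `isIso_morphismRestrict_iSup`,
  `isIso_morphismRestrict_of_isClosedImmersion` (a closed immersion is an isomorphism over any
  open of the reduced target inside its range), `dense_preimage_inter_of_isIso_morphismRestrict`;
* `IsBirational.comp_iso`, `Scheme.IsRegular.of_iso`, `Scheme.IsRegular.coprod`,
  `dense_inl_image_union_inr_image`, `isIso_morphismRestrict_coprodDesc_left/right`;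
* `exists_finite_resolution_of_closed_cover` — the glue; `hasResolution_of_exists_finite`,
  `Scheme.IsRegular.exists_finite`, `exists_finite_resolution_of_iso`.

## Sources

Context only (the statements here are elementary): resolution of curves by normalising each
component — R. Hartshorne, *Algebraic Geometry*, GTM 52, Ch. V, Rem. 3.8.1; J. Kollár,
*Lectures on Resolution of Singularities*, Ann. of Math. Stud. 166, §1.4 (1.29, Thm. 1.30,
Thm. 1.33).
-/

noncomputable section

open CategoryTheory CategoryTheory.Limits AlgebraicGeometry TopologicalSpace Topology

namespace Literature.AlgebraicGeometry.Resolution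

universe u

variable {X Y : Scheme.{u}}

/-! ## Restricting morphisms over opens -/

/-- If `f` is an isomorphism over `U`, it is an isomorphism over every smaller open. [folklore] -/
theorem isIso_morphismRestrict_of_le (f : X ⟶ Y) {U V : Y.Opens} (hU : IsIso (f ∣_ U))
    (hVU : V ≤ U) : IsIso (f ∣_ V) := by
  have h1 : IsIso (f ∣_ U ∣_ (U.ι ⁻¹ᵁ V)) := inferInstance
  have h2 : IsIso (f ∣_ (U.ι ''ᵁ (U.ι ⁻¹ᵁ V))) :=
    ((MorphismProperty.isomorphisms Scheme).arrow_mk_iso_iff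
      (morphismRestrictRestrict f U (U.ι ⁻¹ᵁ V))).mp h1
  have hV : U.ι ''ᵁ (U.ι ⁻¹ᵁ V) = V := by
    rw [Scheme.Hom.image_preimage_eq_opensRange_inf, Scheme.Opens.opensRange_ι, inf_eq_right.mpr hVU]
  exact ((MorphismProperty.isomorphisms Scheme).arrow_mk_iso_iff (morphismRestrictEq f hV)).mp h2

/-- If `f` is an isomorphism over each `V i`, it is an isomorphism over `⨆ i, V i`. [folklore] -/
theorem isIso_morphismRestrict_iSup (f : X ⟶ Y) {ι : Type*} (V : ι → Y.Opens)
    (hV : ∀ i, IsIso (f ∣_ V i)) : IsIso (f ∣_ ⨆ i, V i) := by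
  set U : Y.Opens := ⨆ i, V i
  let W : ι → (U : Scheme.{u}).Opens := fun i => U.ι ⁻¹ᵁ (V i)
  have hW : ⨆ i, W i = ⊤ := by
    refine top_le_iff.mp fun x _ => ?_
    have hx : x.1 ∈ U := x.2
    obtain ⟨i, hi⟩ := Opens.mem_iSup.mp hx
    exact Opens.mem_iSup.mpr ⟨i, hi⟩
  have key : ∀ i, IsIso ((f ∣_ U) ∣_ W i) := by
    intro i
    have hVi : U.ι ''ᵁ (W i) = V i := by
      rw [Scheme.Hom.image_preimage_eq_opensRange_inf, Scheme.Opens.opensRange_ι,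
        inf_eq_right.mpr (le_iSup V i)]
    have h2 : IsIso (f ∣_ (U.ι ''ᵁ (W i))) :=
      ((MorphismProperty.isomorphisms Scheme).arrow_mk_iso_iff (morphismRestrictEq f hVi)).mpr (hV i)
    exact ((MorphismProperty.isomorphisms Scheme).arrow_mk_iso_iff
      (morphismRestrictRestrict f U (W i))).mpr h2
  exact (IsZariskiLocalAtTarget.of_iSup_eq_top (P := MorphismProperty.isomorphisms Scheme) W hW
    (fun i => key i) :)

/-- A closed immersion is an isomorphism over every open subset of the (reduced) target contained
in its range. [folklore] -/
theorem isIso_morphismRestrict_of_isClosedImmersion {C : Scheme.{u}} (ι : C ⟶ X)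
    [IsClosedImmersion ι] [IsReduced X] (O : X.Opens) (hO : (O : Set X) ⊆ Set.range ι) :
    IsIso (ι ∣_ O) := by
  haveI : IsClosedImmersion (ι ∣_ O) := IsZariskiLocalAtTarget.restrict ‹_› O
  haveI : Surjective (ι ∣_ O) := by
    refine ⟨fun x => ?_⟩
    obtain ⟨c, hc⟩ := hO x.2
    refine ⟨⟨c, show ι c ∈ O by rw [hc]; exact x.2⟩, ?_⟩
    apply Subtype.ext
    rw [morphismRestrict_base_coe]
    exact hc
  exact isIso_of_isClosedImmersion_of_surjective _

/-- If `f` is an isomorphism over the open `W` with `f ⁻¹ W` dense, then the preimage of the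
trace on `W` of any dense set `S` is dense. [folklore] -/
theorem dense_preimage_inter_of_isIso_morphismRestrict (f : X ⟶ Y) {W : Y.Opens}
    (hW : IsIso (f ∣_ W)) (hd : Dense ((f ⁻¹ᵁ W : X.Opens) : Set X)) {S : Set Y}
    (hSd : Dense S) : Dense (f ⁻¹' ((W : Set Y) ∩ S)) := by
  rw [dense_iff_inter_open]
  intro O hO hOne
  -- `O ∩ f⁻¹ W` is a nonempty open of `f⁻¹ W`
  obtain ⟨x, hxO, hxW⟩ := hd.inter_open_nonempty O hO hOne
  let e := Scheme.homeoOfIso (asIso (f ∣_ W))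
  -- the open `{y ∈ f⁻¹W | y ∈ O}` of `f ⁻¹ W` maps to an open of `W`, i.e. of `Y`
  let O' : Set (f ⁻¹ᵁ W : X.Opens) := (f ⁻¹ᵁ W).ι ⁻¹' O
  have hO' : IsOpen O' := hO.preimage (f ⁻¹ᵁ W).ι.continuous
  have hO'img : IsOpen (W.ι '' (e '' O')) :=
    W.ι.isOpenEmbedding.isOpenMap _ (e.isOpenMap _ hO')
  have hne : (W.ι '' (e '' O')).Nonempty :=
    ⟨_, ⟨e ⟨x, hxW⟩, ⟨⟨x, hxW⟩, hxO, rfl⟩, rfl⟩⟩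
  obtain ⟨_, ⟨_, ⟨z, hzO, rfl⟩, rfl⟩, hzS⟩ := hSd.inter_open_nonempty _ hO'img hne
  refine ⟨(f ⁻¹ᵁ W).ι z, hzO, ?_⟩
  have hz : W.ι (e z) = f ((f ⁻¹ᵁ W).ι z) := by
    rw [Scheme.Opens.ι_apply, Scheme.Opens.ι_apply]
    exact morphismRestrict_base_coe f W z
  refine ⟨?_, ?_⟩
  · rw [← hz]; exact (e z).2
  · rwa [hz] at hzS

/-! ## Birational maps, regularity: transport -/

/-- Post-composing a birational morphism with an isomorphism gives a birational morphism.
[folklore] -/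
theorem IsBirational.comp_iso {X' X Z : Scheme.{u}} {π : X' ⟶ X} (h : IsBirational π)
    (g : X ⟶ Z) [IsIso g] : IsBirational (π ≫ g) := by
  obtain ⟨U, hU, hU', hiso⟩ := h
  refine ⟨g ''ᵁ U, ?_, ?_, ?_⟩
  · have : (g ''ᵁ U : Set Z) = g '' (U : Set X) := rfl
    rw [this]
    exact (Scheme.homeoOfIso (asIso g)).surjective.denseRange.dense_image g.continuous hU
  · rwa [Scheme.Hom.comp_preimage, Scheme.Hom.preimage_image_eq]
  · rw [morphismRestrict_comp]
    have h1 : IsIso (π ∣_ g ⁻¹ᵁ (g ''ᵁ U)) :=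
      ((MorphismProperty.isomorphisms Scheme).arrow_mk_iso_iff
        (morphismRestrictEq π (g.preimage_image_eq U).symm)).mp hiso
    refine @IsIso.comp_isIso _ _ _ _ _ _ _ h1 ?_
    infer_instance

/-- Regularity of schemes is invariant under isomorphism. [folklore] -/
theorem Scheme.IsRegular.of_iso {X Y : Scheme.{u}} (e : X ⟶ Y) [IsIso e] (h : Scheme.IsRegular X) :
    Scheme.IsRegular Y := by
  intro y
  obtain ⟨x, rfl⟩ := (inferInstance : Surjective e).1 y
  haveI := h x
  exact IsRegularLocalRing.of_ringEquiv (asIso (e.stalkMap x)).commRingCatIsoToRingEquiv.symm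

/-! ## Disjoint unions -/

/-- Every point of `X ⨿ Y` comes from `X` or from `Y`. [folklore] -/
theorem coprod_point_cases {X Y : Scheme.{u}} (z : ↥(X ⨿ Y)) :
    (∃ x : X, (coprod.inl : X ⟶ X ⨿ Y) x = z) ∨ (∃ y : Y, (coprod.inr : Y ⟶ X ⨿ Y) y = z) := by
  obtain ⟨w, rfl⟩ := (coprodMk X Y).surjective z
  rcases w with x | y
  · exact Or.inl ⟨x, (coprodMk_inl X Y x).symm⟩
  · exact Or.inr ⟨y, (coprodMk_inr X Y y).symm⟩

/-- The disjoint union of two regular schemes is regular. [folklore] -/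
theorem Scheme.IsRegular.coprod {X Y : Scheme.{u}} (hX : Scheme.IsRegular X)
    (hY : Scheme.IsRegular Y) : Scheme.IsRegular (X ⨿ Y) := by
  intro z
  rcases coprod_point_cases z with ⟨x, rfl⟩ | ⟨y, rfl⟩
  · haveI := hX x
    exact IsRegularLocalRing.of_ringEquiv
      (asIso ((coprod.inl : X ⟶ X ⨿ Y).stalkMap x)).commRingCatIsoToRingEquiv.symm
  · haveI := hY y
    exact IsRegularLocalRing.of_ringEquiv
      (asIso ((coprod.inr : Y ⟶ X ⨿ Y).stalkMap y)).commRingCatIsoToRingEquiv.symm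

/-- Dense subsets of the summands give a dense subset of the disjoint union. [folklore] -/
theorem dense_inl_image_union_inr_image {X Y : Scheme.{u}} {A : Set X} {B : Set Y}
    (hA : Dense A) (hB : Dense B) :
    Dense ((coprod.inl : X ⟶ X ⨿ Y) '' A ∪ (coprod.inr : Y ⟶ X ⨿ Y) '' B) := by
  intro z
  rw [closure_union]
  rcases coprod_point_cases z with ⟨x, rfl⟩ | ⟨y, rfl⟩
  · left
    refine image_closure_subset_closure_image (coprod.inl : X ⟶ X ⨿ Y).continuous ?_
    exact ⟨x, hA x, rfl⟩
  · right
    refine image_closure_subset_closure_image (coprod.inr : Y ⟶ X ⨿ Y).continuous ?_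
    exact ⟨y, hB y, rfl⟩

/-- If `g` misses the open `O` and `f` is an isomorphism over `O`, then `coprod.desc f g` is an
isomorphism over `O`. [folklore] -/
theorem isIso_morphismRestrict_coprodDesc_left {A B X : Scheme.{u}} (f : A ⟶ X) (g : B ⟶ X)
    (O : X.Opens) (hg : ∀ b : B, g b ∉ O) (hf : IsIso (f ∣_ O)) :
    IsIso (coprod.desc f g ∣_ O) := by
  have h1 : IsIso ((coprod.inl ≫ coprod.desc f g) ∣_ O) := by rw [coprod.inl_desc]; exact hf
  rw [morphismRestrict_comp] at h1
  haveI : Surjective ((coprod.inl : A ⟶ A ⨿ B) ∣_ (coprod.desc f g ⁻¹ᵁ O)) := by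
    refine ⟨fun z => ?_⟩
    rcases coprod_point_cases ((coprod.desc f g ⁻¹ᵁ O).ι z) with ⟨a, ha⟩ | ⟨b, hb⟩
    · refine ⟨⟨a, show (coprod.inl : A ⟶ A ⨿ B) a ∈ coprod.desc f g ⁻¹ᵁ O by
        rw [ha, Scheme.Opens.ι_apply]; exact z.2⟩, ?_⟩
      apply Subtype.ext
      rw [morphismRestrict_base_coe]
      rw [Scheme.Opens.ι_apply] at ha
      exact ha
    · exfalso
      apply hg b
      have h2 : (coprod.desc f g) ((coprod.desc f g ⁻¹ᵁ O).ι z) ∈ O := by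
        rw [Scheme.Opens.ι_apply]; exact z.2
      rw [← hb, ← Scheme.Hom.comp_apply, coprod.inr_desc] at h2
      exact h2
  haveI : IsIso ((coprod.inl : A ⟶ A ⨿ B) ∣_ (coprod.desc f g ⁻¹ᵁ O)) :=
    (isIso_iff_isOpenImmersion_and_surjective _).mpr ⟨inferInstance, inferInstance⟩
  exact @IsIso.of_isIso_comp_left _ _ _ _ _ _ _ this h1

/-- If `f` misses the open `O` and `g` is an isomorphism over `O`, then `coprod.desc f g` is an
isomorphism over `O`. [folklore] -/
theorem isIso_morphismRestrict_coprodDesc_right {A B X : Scheme.{u}} (f : A ⟶ X) (g : B ⟶ X)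
    (O : X.Opens) (hf : ∀ a : A, f a ∉ O) (hg : IsIso (g ∣_ O)) :
    IsIso (coprod.desc f g ∣_ O) := by
  have h1 : IsIso ((coprod.inr ≫ coprod.desc f g) ∣_ O) := by rw [coprod.inr_desc]; exact hg
  rw [morphismRestrict_comp] at h1
  haveI : Surjective ((coprod.inr : B ⟶ A ⨿ B) ∣_ (coprod.desc f g ⁻¹ᵁ O)) := by
    refine ⟨fun z => ?_⟩
    rcases coprod_point_cases ((coprod.desc f g ⁻¹ᵁ O).ι z) with ⟨a, ha⟩ | ⟨b, hb⟩
    · exfalso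
      apply hf a
      have h2 : (coprod.desc f g) ((coprod.desc f g ⁻¹ᵁ O).ι z) ∈ O := by
        rw [Scheme.Opens.ι_apply]; exact z.2
      rw [← ha, ← Scheme.Hom.comp_apply, coprod.inl_desc] at h2
      exact h2
    · refine ⟨⟨b, show (coprod.inr : B ⟶ A ⨿ B) b ∈ coprod.desc f g ⁻¹ᵁ O by
        rw [hb, Scheme.Opens.ι_apply]; exact z.2⟩, ?_⟩
      apply Subtype.ext
      rw [morphismRestrict_base_coe]
      rw [Scheme.Opens.ι_apply] at hb
      exact hb
  haveI : IsIso ((coprod.inr : B ⟶ A ⨿ B) ∣_ (coprod.desc f g ⁻¹ᵁ O)) :=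
    (isIso_iff_isOpenImmersion_and_surjective _).mpr ⟨inferInstance, inferInstance⟩
  exact @IsIso.of_isIso_comp_left _ _ _ _ _ _ _ this h1

/-- Binary version of `isIso_morphismRestrict_iSup`. [folklore] -/
theorem isIso_morphismRestrict_sup (f : X ⟶ Y) {V₁ V₂ : Y.Opens} (h₁ : IsIso (f ∣_ V₁))
    (h₂ : IsIso (f ∣_ V₂)) : IsIso (f ∣_ (V₁ ⊔ V₂)) := by
  rw [sup_eq_iSup]
  exact isIso_morphismRestrict_iSup f _ fun b => by cases b <;> assumption

/-! ## The glue -/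

/-- **Gluing finite resolutions along a closed cover.** Let the reduced scheme `X` be covered by
two closed subschemes `ι₁ : C ↪ X`, `ι₂ : D ↪ X` such that the complement of `D` is dense in `C`
and the complement of `C` is dense in `D` (no component of one lies in the other). If `C` and `D`
admit finite birational morphisms from regular schemes, so does `X`: the disjoint union
`C' ⨿ D' → X` (it is an isomorphism over the dense open
`(O₁ ∖ D) ∪ (O₂ ∖ C)`, where `ρᵢ` is an isomorphism over `Oᵢ`). [folklore] -/
theorem exists_finite_resolution_of_closed_cover {C D X : Scheme.{u}} [IsReduced X]
    (ι₁ : C ⟶ X) (ι₂ : D ⟶ X) [IsClosedImmersion ι₁] [IsClosedImmersion ι₂]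
    (hcov : Set.range ι₁ ∪ Set.range ι₂ = Set.univ)
    (hd₁ : Dense (ι₁ ⁻¹' (Set.range ι₂)ᶜ)) (hd₂ : Dense (ι₂ ⁻¹' (Set.range ι₁)ᶜ))
    (h₁ : ∃ (C' : Scheme.{u}) (ρ : C' ⟶ C), IsFinite ρ ∧ IsBirational ρ ∧ Scheme.IsRegular C')
    (h₂ : ∃ (D' : Scheme.{u}) (ρ : D' ⟶ D), IsFinite ρ ∧ IsBirational ρ ∧ Scheme.IsRegular D') :
    ∃ (X' : Scheme.{u}) (π : X' ⟶ X), IsFinite π ∧ IsBirational π ∧ Scheme.IsRegular X' := by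
  obtain ⟨C', ρ₁, hfin₁, ⟨W₁, hW₁, hW₁', hiso₁⟩, hreg₁⟩ := h₁
  obtain ⟨D', ρ₂, hfin₂, ⟨W₂, hW₂, hW₂', hiso₂⟩, hreg₂⟩ := h₂
  -- the open complements of the two closed pieces
  let A : X.Opens := ⟨(Set.range ι₂)ᶜ, ι₂.isClosedEmbedding.isClosed_range.isOpen_compl⟩
  let B : X.Opens := ⟨(Set.range ι₁)ᶜ, ι₁.isClosedEmbedding.isClosed_range.isOpen_compl⟩
  have hA : (A : Set X) ⊆ Set.range ι₁ := by
    intro x hx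
    have hx' : x ∈ Set.range ι₁ ∪ Set.range ι₂ := by rw [hcov]; trivial
    exact hx'.resolve_right hx
  have hB : (B : Set X) ⊆ Set.range ι₂ := by
    intro x hx
    have hx' : x ∈ Set.range ι₁ ∪ Set.range ι₂ := by rw [hcov]; trivial
    exact hx'.resolve_left hx
  -- opens of `X` inducing `W₁`, `W₂`
  obtain ⟨O₁, hO₁, hO₁W⟩ := ι₁.isClosedEmbedding.isInducing.isOpen_iff.mp W₁.2
  obtain ⟨O₂, hO₂, hO₂W⟩ := ι₂.isClosedEmbedding.isInducing.isOpen_iff.mp W₂.2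
  let V₁ : X.Opens := ⟨O₁, hO₁⟩ ⊓ A
  let V₂ : X.Opens := ⟨O₂, hO₂⟩ ⊓ B
  have hV₁W : ι₁ ⁻¹ᵁ V₁ ≤ W₁ := by
    intro c hc
    have hc' : ι₁ c ∈ O₁ := hc.1
    have : c ∈ ι₁ ⁻¹' O₁ := hc'
    rw [hO₁W] at this
    exact this
  have hV₂W : ι₂ ⁻¹ᵁ V₂ ≤ W₂ := by
    intro d hd
    have hd' : ι₂ d ∈ O₂ := hd.1
    have : d ∈ ι₂ ⁻¹' O₂ := hd'
    rw [hO₂W] at this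
    exact this
  haveI := hfin₁
  haveI := hfin₂
  let π : C' ⨿ D' ⟶ X := coprod.desc (ρ₁ ≫ ι₁) (ρ₂ ≫ ι₂)
  have hπ₁ : ∀ c' : C', π ((coprod.inl : C' ⟶ C' ⨿ D') c') = ι₁ (ρ₁ c') := by
    intro c'
    rw [← Scheme.Hom.comp_apply, coprod.inl_desc, Scheme.Hom.comp_apply]
  have hπ₂ : ∀ d' : D', π ((coprod.inr : D' ⟶ C' ⨿ D') d') = ι₂ (ρ₂ d') := by
    intro d'
    rw [← Scheme.Hom.comp_apply, coprod.inr_desc, Scheme.Hom.comp_apply]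
  -- the dense pieces upstairs
  have hS₁ : Dense ((W₁ : Set C) ∩ ι₁ ⁻¹' (A : Set X)) := hW₁.inter_of_isOpen_left hd₁ W₁.2
  have hS₂ : Dense ((W₂ : Set D) ∩ ι₂ ⁻¹' (B : Set X)) := hW₂.inter_of_isOpen_left hd₂ W₂.2
  have hS₁V : ι₁ '' ((W₁ : Set C) ∩ ι₁ ⁻¹' (A : Set X)) ⊆ (V₁ : Set X) := by
    rintro _ ⟨c, ⟨hcW, hcA⟩, rfl⟩
    refine ⟨?_, hcA⟩
    have : c ∈ ι₁ ⁻¹' O₁ := by rw [hO₁W]; exact hcW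
    exact this
  have hS₂V : ι₂ '' ((W₂ : Set D) ∩ ι₂ ⁻¹' (B : Set X)) ⊆ (V₂ : Set X) := by
    rintro _ ⟨d, ⟨hdW, hdB⟩, rfl⟩
    refine ⟨?_, hdB⟩
    have : d ∈ ι₂ ⁻¹' O₂ := by rw [hO₂W]; exact hdW
    exact this
  refine ⟨C' ⨿ D', π, inferInstance, ⟨V₁ ⊔ V₂, ?_, ?_, ?_⟩, hreg₁.coprod hreg₂⟩
  · -- `V₁ ∪ V₂` is dense in `X`
    intro x
    have hx : x ∈ Set.range ι₁ ∪ Set.range ι₂ := by rw [hcov]; trivial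
    rcases hx with ⟨c, rfl⟩ | ⟨d, rfl⟩
    · have h1 : ι₁ c ∈ closure (ι₁ '' ((W₁ : Set C) ∩ ι₁ ⁻¹' (A : Set X))) :=
        image_closure_subset_closure_image ι₁.continuous ⟨c, hS₁ c, rfl⟩
      exact closure_mono (hS₁V.trans Set.subset_union_left) h1
    · have h2 : ι₂ d ∈ closure (ι₂ '' ((W₂ : Set D) ∩ ι₂ ⁻¹' (B : Set X))) :=
        image_closure_subset_closure_image ι₂.continuous ⟨d, hS₂ d, rfl⟩
      exact closure_mono (hS₂V.trans Set.subset_union_right) h2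
  · -- the preimage of `V₁ ∪ V₂` is dense in `C' ⨿ D'`
    have hT₁ : Dense (ρ₁ ⁻¹' ((W₁ : Set C) ∩ ι₁ ⁻¹' (A : Set X))) :=
      dense_preimage_inter_of_isIso_morphismRestrict ρ₁ hiso₁ hW₁' hd₁
    have hT₂ : Dense (ρ₂ ⁻¹' ((W₂ : Set D) ∩ ι₂ ⁻¹' (B : Set X))) :=
      dense_preimage_inter_of_isIso_morphismRestrict ρ₂ hiso₂ hW₂' hd₂
    refine (dense_inl_image_union_inr_image hT₁ hT₂).mono ?_
    rintro z (⟨c', hc', rfl⟩ | ⟨d', hd', rfl⟩)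
    · show π ((coprod.inl : C' ⟶ C' ⨿ D') c') ∈ V₁ ⊔ V₂
      rw [hπ₁]
      exact Or.inl (hS₁V ⟨ρ₁ c', hc', rfl⟩)
    · show π ((coprod.inr : D' ⟶ C' ⨿ D') d') ∈ V₁ ⊔ V₂
      rw [hπ₂]
      exact Or.inr (hS₂V ⟨ρ₂ d', hd', rfl⟩)
  · -- `π` is an isomorphism over `V₁ ∪ V₂`
    refine isIso_morphismRestrict_sup π ?_ ?_
    · refine isIso_morphismRestrict_coprodDesc_left _ _ V₁ (fun d' h => ?_) ?_
      · rw [Scheme.Hom.comp_apply] at h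
        exact h.2 ⟨ρ₂ d', rfl⟩
      · rw [morphismRestrict_comp]
        have e1 : IsIso (ρ₁ ∣_ ι₁ ⁻¹ᵁ V₁) := isIso_morphismRestrict_of_le ρ₁ hiso₁ hV₁W
        have e2 : IsIso (ι₁ ∣_ V₁) :=
          isIso_morphismRestrict_of_isClosedImmersion ι₁ V₁ fun x hx => hA hx.2
        exact @IsIso.comp_isIso _ _ _ _ _ _ _ e1 e2
    · refine isIso_morphismRestrict_coprodDesc_right _ _ V₂ (fun c' h => ?_) ?_
      · rw [Scheme.Hom.comp_apply] at h
        exact h.2 ⟨ρ₁ c', rfl⟩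
      · rw [morphismRestrict_comp]
        have e1 : IsIso (ρ₂ ∣_ ι₂ ⁻¹ᵁ V₂) := isIso_morphismRestrict_of_le ρ₂ hiso₂ hV₂W
        have e2 : IsIso (ι₂ ∣_ V₂) :=
          isIso_morphismRestrict_of_isClosedImmersion ι₂ V₂ fun x hx => hB hx.2
        exact @IsIso.comp_isIso _ _ _ _ _ _ _ e1 e2

/-- A finite birational morphism from a regular scheme is a resolution. [folklore] -/
theorem hasResolution_of_exists_finite {X : Scheme.{u}}
    (h : ∃ (X' : Scheme.{u}) (π : X' ⟶ X), IsFinite π ∧ IsBirational π ∧ Scheme.IsRegular X') :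
    Scheme.HasResolution X := by
  obtain ⟨X', π, hfin, hbir, hreg⟩ := h
  haveI := hfin
  exact ⟨X', π, inferInstance, hbir, hreg⟩

/-- A regular scheme has the identity as a finite resolution. [folklore] -/
theorem Scheme.IsRegular.exists_finite {X : Scheme.{u}} (h : Scheme.IsRegular X) :
    ∃ (X' : Scheme.{u}) (π : X' ⟶ X), IsFinite π ∧ IsBirational π ∧ Scheme.IsRegular X' := by
  refine ⟨X, 𝟙 X, inferInstance, ⟨⊤, ?_, ?_, ?_⟩, h⟩
  · simp
  · simp
  · infer_instance

/-- Finite resolutions transport along isomorphisms of the target. [folklore] -/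
theorem exists_finite_resolution_of_iso {X Z : Scheme.{u}} (g : X ⟶ Z) [IsIso g]
    (h : ∃ (X' : Scheme.{u}) (π : X' ⟶ X), IsFinite π ∧ IsBirational π ∧ Scheme.IsRegular X') :
    ∃ (Z' : Scheme.{u}) (π : Z' ⟶ Z), IsFinite π ∧ IsBirational π ∧ Scheme.IsRegular Z' := by
  obtain ⟨X', π, hfin, hbir, hreg⟩ := h
  haveI := hfin
  exact ⟨X', π ≫ g, inferInstance, hbir.comp_iso g, hreg⟩

end Literature.AlgebraicGeometry.Resolution

end
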